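import Literature.MathematicalPhysics.QuantumFieldTheory.Balaban1983to89.B9Eq3132ApproxRightInverse
import Literature.MathematicalPhysics.QuantumFieldTheory.Balaban1983to89.B9Eq3132CoerciveFromGA

/-!
# `Balaban1983to89.B9Eq3132CoerciveFromEnergy` — T. Bałaban, *Propagators for lattice gauge theories in a background field*, Commun. Math. Phys. **99** (1985) 389–434
# [Balaban1985BackgroundPropagators], (3.132) p. 422 with [Balaban1984PropagatorsII] (2.147) p. 248: THE ROW-26 COERCIVITY BINDERS OF THE N06 CERTIFICATE FROM
# ROW 17's POSITIVITY OF `Δ_a(U)` AND ONE ENERGY BOUND (P′1) FOR THE EXPLICIT TRANSPORTED TENT BUMPS — the composition of the four landed reductions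

statement-level skeleton of published theorems with citation tags; proofs where landed; nothing here is a claim about the Yang–Mills mass gap

THE PRINT.  [B9] p. 422 (3.132) (the lower bound `γ₀` on `Q(U)G(U)Q*(U)` in Thm 3.12's proof, «as in [4] (2.147)») and [4] p. 248 («bounded from below by an inverse
of an upper bound of this form»): a test family `T` with `Q(U)T ≈ 1` against `Λ⁻¹` and bounded `Δ_a(U)`-energy gives the coercivity.

WHY THIS FILE (dag-n06-i gen 13, N06 bundle F4, row 26).  The chain is now: `hco26 ∧ hco₁26` (the certificate's :254∕:256)
⇐ `B9Eq3132CoerciveFromGA.hco26_of_hcoA_step12` (perturbation by row 20's steps) ⇐ `hcoA` ⇐ `B9Eq3132CoerciveVariational.hcoA_of_testFamily` ⇐ row 17's `hΔA` + a test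
family with (P′2) ∧ (P′1); `B9Eq3132ApproxRightInverse.p2_bump_member` PROVES (P′2) for `T x U := tentOp (bumpProfile) U` with `ϑ = ⅞`.  THIS FILE composes them:
★★★ `hco26_of_energy_step12` — both coercivity binders from `hΔA` (row 17's displayed shape), the row-20 inputs of `hco26_of_hcoA_step12` (verbatim), and ONE displayed
estimate `hP1`: the `Δ_a(U)`-energy of the transported bumps, `trIP 1 (TΨ) (Δ_a(U)(TΨ)) ≤ C·trIP 1 Ψ Ψ` under (3.35)∕(3.36) — at the basis `trBasis N` (family index
`TrIdx N`) of the ring-inverse reading.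

WHAT IS PROVED (sorry-free).  `testFamily_bump` (hT of `hcoA_of_testFamily` from `hP1`, `ϑ = ⅞`), `hcoA_of_energy` (hcoA from `hΔA` + `hP1`),
★★★ `hco26_of_energy_step12`.

HONEST SCOPE.  Composition of landed theorems; `hΔA` (row 17), `hP1` and row 20's step schema remain displayed hypotheses of printed∕elementary shape; nothing of [B9] is
asserted; count-neutral; N06 NOT discharged.  Cell `pub-ymgap` (HUMAN RULING D-0062), Track A node N06 [B9], seat `pub-ymgap-dag-n06-i` (gen 13), 2026-08-27; a NEW file.
-/

noncomputable section

namespace Literature.MathematicalPhysics.QuantumFieldTheory.Balaban1983to89.B9Eq3132CoerciveFromEnergy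

open Node00
open B6KLevelCensusIndexV1 (KIdx)
open B6GlobalChartV1 (blkV1)
open B6Ineq2142KLevelV1 (lvl β)
open B9Thm34Ext (toB6)
open B9Thm312Whole (Ops Thm33G0 Step FormSmall Identities GeoOK)
open B9PinMembersKLevelV1 (MemberY geo9Y bg9Y)
open B7Prop2SpecialUnitary (specialUnitaryUnits)
open B9CoReadingCoords (XBK blkBK GcoK)
open B9CoReadingCoordsTranspose (TrIdx trBasis)
open B9Thm311ReadingCoords (trIP PosDefTr)
open B9RWSumsReadsNbr (nbr)
open B9Eq3132RingInverseReading (normMatY)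
open B9Eq3132NuReading (lamInvY)
open B9Eq3132CTInputs (CoerciveUnder)
open B9Eq3132ScalarIndex (geoComap)
open B9Eq3132SectDLetters (QGQY)
open B9Eq3132TentOperator (tentOp)
open B9Eq3132ApproxRightInverse (bumpProfile p2_bump_member)
open B9Eq3132CoerciveVariational (hcoA_of_testFamily)
open B9Eq3132CoerciveFromGA (hco26_of_hcoA_step12)
open scoped Matrix.Norms.L2Operator

variable {κ : Type} [Fintype κ] [DecidableEq κ] {N : ℕ}

/-- ★ **THE TEST-FAMILY HYPOTHESIS OF `hcoA_of_testFamily` FOR THE TRANSPORTED BUMPS, FROM (P′1) ALONE** ((P′2) is `p2_bump_member`, `ϑ = ⅞`).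
[cite: Balaban1984PropagatorsII, (2.147) p.248; Balaban1985BackgroundPropagators, (3.132) p.422] -/
theorem testFamily_bump (θ : Stage3Params) (Mstar : ℕ) {c35 : ℝ}
    (hP1 : ∃ Mt aT C : ℝ, 0 < Mt ∧ 0 < aT ∧ 0 < C ∧
      ∀ x : MemberY θ.d₆ θ.ℓ₆ θ.hd' θ.hL' θ.b₀ θ.b₁ Mstar, Mt ≤ (geo9Y x).M → ∀ α₀ : ℝ, 0 < α₀ → (geo9Y x).M * α₀ ≤ aT →
        ∀ U : (bg9Y (Matrix (Fin N) (Fin N) ℂ) (specialUnitaryUnits (Fin N)) x).Cfg,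
          (bg9Y (Matrix (Fin N) (Fin N) ℂ) (specialUnitaryUnits (Fin N)) x).Reg335 c35 α₀ U → (bg9Y (Matrix (Fin N) (Fin N) ℂ) (specialUnitaryUnits (Fin N)) x).Reg336 c35 α₀ U →
            ∀ Ψ : IBondY x.toKIdx → Matrix (Fin N) (Fin N) ℂ,
              trIP (fun _ => (1 : ℝ)) (tentOp x.toKIdx (bumpProfile x.toKIdx) U Ψ)
                  (deltaAY x.toKIdx (parSymY x.toKIdx) (parBY x.toKIdx) (GpY x.toKIdx (parSymY x.toKIdx)) U (tentOp x.toKIdx (bumpProfile x.toKIdx) U Ψ)) ≤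
                C * trIP (fun _ => (1 : ℝ)) Ψ Ψ) :
    ∃ Mt aT ϑ C : ℝ, 0 < Mt ∧ 0 < aT ∧ ϑ < 1 ∧ 0 < C ∧
      ∀ x : MemberY θ.d₆ θ.ℓ₆ θ.hd' θ.hL' θ.b₀ θ.b₁ Mstar, Mt ≤ (geo9Y x).M → ∀ α₀ : ℝ, 0 < α₀ → (geo9Y x).M * α₀ ≤ aT →
        ∀ U : (bg9Y (Matrix (Fin N) (Fin N) ℂ) (specialUnitaryUnits (Fin N)) x).Cfg,
          (bg9Y (Matrix (Fin N) (Fin N) ℂ) (specialUnitaryUnits (Fin N)) x).Reg335 c35 α₀ U → (bg9Y (Matrix (Fin N) (Fin N) ℂ) (specialUnitaryUnits (Fin N)) x).Reg336 c35 α₀ U →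
            (∀ Ψ : IBondY x.toKIdx → Matrix (Fin N) (Fin N) ℂ,
              (1 - ϑ) * trIP (fun _ => (1 : ℝ)) Ψ Ψ ≤
                trIP (fun _ => (1 : ℝ)) (QY x.toKIdx (parBY x.toKIdx) U (tentOp x.toKIdx (bumpProfile x.toKIdx) U Ψ)) (fun y => lamInvY x.toKIdx y • Ψ y)) ∧
            (∀ Ψ : IBondY x.toKIdx → Matrix (Fin N) (Fin N) ℂ,
              trIP (fun _ => (1 : ℝ)) (tentOp x.toKIdx (bumpProfile x.toKIdx) U Ψ)
                  (deltaAY x.toKIdx (parSymY x.toKIdx) (parBY x.toKIdx) (GpY x.toKIdx (parSymY x.toKIdx)) U (tentOp x.toKIdx (bumpProfile x.toKIdx) U Ψ)) ≤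
                C * trIP (fun _ => (1 : ℝ)) Ψ Ψ) := by
  obtain ⟨Mt, aT, C, hMt, haT, hC, hP⟩ := hP1
  exact ⟨Mt, aT, 7 / 8, C, hMt, haT, by norm_num, hC, fun x hM α₀ hα hMa U h335 h336 =>
    ⟨fun Ψ => p2_bump_member x h335 Ψ, hP x hM α₀ hα hMa U h335 h336⟩⟩

/-- ★★ **THE COERCIVITY `hcoA` OF `Q(U)G_A(U)Q*(U)` FROM ROW 17's `hΔA` AND THE ENERGY BOUND (P′1)** at the basis `trBasis N`.
[cite: Balaban1984PropagatorsII, (2.147) p.248; Balaban1985BackgroundPropagators, (3.132) p.422, Thm 3.11 p.416] -/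
theorem hcoA_of_energy (θ : Stage3Params) (Mstar : ℕ) (𝔯 : ResY N θ Mstar)
    [∀ x : MemberY θ.d₆ θ.ℓ₆ θ.hd' θ.hL' θ.b₀ θ.b₁ Mstar, Fintype (geo9Y x).Site]
    [∀ x : MemberY θ.d₆ θ.ℓ₆ θ.hd' θ.hL' θ.b₀ θ.b₁ Mstar, DecidableEq (geo9Y x).Site] {c35 : ℝ}
    (a311 M311 : ℝ) (ha311 : 0 < a311) (hM311 : 0 < M311)
    (hΔA : ∀ x : MemberY θ.d₆ θ.ℓ₆ θ.hd' θ.hL' θ.b₀ θ.b₁ Mstar, M311 ≤ (geo9Y x).M → ∀ α₀ : ℝ, 0 < α₀ → (geo9Y x).M * α₀ ≤ a311 →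
      ∀ U : (bg9Y (Matrix (Fin N) (Fin N) ℂ) (specialUnitaryUnits (Fin N)) x).Cfg, (bg9Y (Matrix (Fin N) (Fin N) ℂ) (specialUnitaryUnits (Fin N)) x).Reg335 c35 α₀ U →
        PosDefTr (fun _ => (1 : ℝ)) (deltaAY x.toKIdx (parSymY x.toKIdx) (parBY x.toKIdx) (GpY x.toKIdx (parSymY x.toKIdx)) U))
    (hP1 : ∃ Mt aT C : ℝ, 0 < Mt ∧ 0 < aT ∧ 0 < C ∧
      ∀ x : MemberY θ.d₆ θ.ℓ₆ θ.hd' θ.hL' θ.b₀ θ.b₁ Mstar, Mt ≤ (geo9Y x).M → ∀ α₀ : ℝ, 0 < α₀ → (geo9Y x).M * α₀ ≤ aT →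
        ∀ U : (bg9Y (Matrix (Fin N) (Fin N) ℂ) (specialUnitaryUnits (Fin N)) x).Cfg,
          (bg9Y (Matrix (Fin N) (Fin N) ℂ) (specialUnitaryUnits (Fin N)) x).Reg335 c35 α₀ U → (bg9Y (Matrix (Fin N) (Fin N) ℂ) (specialUnitaryUnits (Fin N)) x).Reg336 c35 α₀ U →
            ∀ Ψ : IBondY x.toKIdx → Matrix (Fin N) (Fin N) ℂ,
              trIP (fun _ => (1 : ℝ)) (tentOp x.toKIdx (bumpProfile x.toKIdx) U Ψ)
                  (deltaAY x.toKIdx (parSymY x.toKIdx) (parBY x.toKIdx) (GpY x.toKIdx (parSymY x.toKIdx)) U (tentOp x.toKIdx (bumpProfile x.toKIdx) U Ψ)) ≤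
                C * trIP (fun _ => (1 : ℝ)) Ψ Ψ) :
    CoerciveUnder c35
      (fun x : MemberY θ.d₆ θ.ℓ₆ θ.hd' θ.hL' θ.b₀ θ.b₁ Mstar => geoComap (geo9Y x) (Prod.fst : (geo9Y x).Site × TrIdx N → (geo9Y x).Site))
      (bg9Y (Matrix (Fin N) (Fin N) ℂ) (specialUnitaryUnits (Fin N)))
      (fun x U => normMatY (trBasis N) (lamInvY x.toKIdx) (QGQOfY x.toKIdx (parBY x.toKIdx) (lettersYOfRecordV4 N θ Mstar 𝔯 x).GA U)) :=
  hcoA_of_testFamily θ Mstar 𝔯 a311 M311 ha311 hM311 hΔA (fun x U Ψ => tentOp x.toKIdx (bumpProfile x.toKIdx) U Ψ) (testFamily_bump θ Mstar hP1)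

/-- ★★★ **ROW 26 OF THE CERTIFICATE FROM ROW 17 AND ONE ENERGY ESTIMATE**: the two coercivity binders `hco26` (for `Q(U)G(U)Q*(U)`, n08's letters) and `hco₁26`
(for `Q(U)G₁(U)Q*(U)`) of `…N06AtOpsYNuOfRecordV6EPairM*` at the basis `trBasis N`, family index `TrIdx N`, from: row 17's displayed `hΔA`; the energy bound (P′1) of the
transported tent bumps; and row 20's step schema at the pins (the inputs of `B9Eq3132CoerciveFromGA.hco26_of_hcoA_step12`, verbatim).
[cite: Balaban1985BackgroundPropagators, (3.132) p.422, Thm 3.12 pp.421–423; Balaban1984PropagatorsII, (2.147) p.248] -/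
theorem hco26_of_energy_step12 (θ : Stage3Params) (Mstar : ℕ) (𝔯 : ResY N θ Mstar)
    [∀ x : MemberY θ.d₆ θ.ℓ₆ θ.hd' θ.hL' θ.b₀ θ.b₁ Mstar, Fintype (geo9Y x).Site]
    [∀ x : MemberY θ.d₆ θ.ℓ₆ θ.hd' θ.hL' θ.b₀ θ.b₁ Mstar, DecidableEq (geo9Y x).Site]
    {Y Z W : MemberY θ.d₆ θ.ℓ₆ θ.hd' θ.hL' θ.b₀ θ.b₁ Mstar → Type} [∀ x, Fintype (Z x)] [∀ x, Fintype (W x)]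
    (bK : Module.Basis κ ℝ (Matrix (Fin N) (Fin N) ℂ)) {c35 : ℝ}
    (𝔬 : ∀ x : MemberY θ.d₆ θ.ℓ₆ θ.hd' θ.hL' θ.b₀ θ.b₁ Mstar,
      Ops (geo9Y x) (bg9Y (Matrix (Fin N) (Fin N) ℂ) (specialUnitaryUnits (Fin N)) x) (XBK κ x.toKIdx) (Y x) (Z x) (W x))
    (H₀ : MemberY θ.d₆ θ.ℓ₆ θ.hd' θ.hL' θ.b₀ θ.b₁ Mstar → Prop)
    {bI : ∀ x : MemberY θ.d₆ θ.ℓ₆ θ.hd' θ.hL' θ.b₀ θ.b₁ Mstar, FBondY x.toKIdx → IBondY x.toKIdx}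
    (hblk : ∀ x, (𝔬 x).blk = blkBK x.toKIdx (bI x))
    (hGco : ∀ (x : MemberY θ.d₆ θ.ℓ₆ θ.hd' θ.hL' θ.b₀ θ.b₁ Mstar) (U : (bg9Y (Matrix (Fin N) (Fin N) ℂ) (specialUnitaryUnits (Fin N)) x).Cfg),
      (𝔬 x).G U = GcoK x.toKIdx bK (bg9Y (Matrix (Fin N) (Fin N) ℂ) (specialUnitaryUnits (Fin N)) x) (fun U => U) (lettersYOfRecordV4 N θ Mstar 𝔯 x).GD U)
    (hG1co : ∀ (x : MemberY θ.d₆ θ.ℓ₆ θ.hd' θ.hL' θ.b₀ θ.b₁ Mstar) (U : (bg9Y (Matrix (Fin N) (Fin N) ℂ) (specialUnitaryUnits (Fin N)) x).Cfg),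
      (𝔬 x).G1 U = GcoK x.toKIdx bK (bg9Y (Matrix (Fin N) (Fin N) ℂ) (specialUnitaryUnits (Fin N)) x) (fun U => U) (lettersYOfRecordV4 N θ Mstar 𝔯 x).G₁ U)
    (hG0co : ∀ (x : MemberY θ.d₆ θ.ℓ₆ θ.hd' θ.hL' θ.b₀ θ.b₁ Mstar) (U : (bg9Y (Matrix (Fin N) (Fin N) ℂ) (specialUnitaryUnits (Fin N)) x).Cfg),
      (𝔬 x).G0 U = GcoK x.toKIdx bK (bg9Y (Matrix (Fin N) (Fin N) ℂ) (specialUnitaryUnits (Fin N)) x) (fun U => U) (lettersYOfRecordV4 N θ Mstar 𝔯 x).GA U)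
    (hlev : ∀ (x : MemberY θ.d₆ θ.ℓ₆ θ.hd' θ.hL' θ.b₀ θ.b₁ Mstar) (f : FBondY x.toKIdx), lvl x.hN x.D x.hk (bI x f) = (blkV1 x.hN x.D f).1.1)
    (hβ1 : ∀ (x : MemberY θ.d₆ θ.ℓ₆ θ.hd' θ.hL' θ.b₀ θ.b₁ Mstar) (f : FBondY x.toKIdx),
      (B6Geom246MultiLevelTorus.geomT x.D).dist (β x.hN x.D x.hk (bI x f)) (blkV1 x.hN x.D f) ≤ 1)
    {mN : ℕ} (hnbr : ∀ (x : MemberY θ.d₆ θ.ℓ₆ θ.hd' θ.hL' θ.b₀ θ.b₁ Mstar) (y : (geo9Y x).Site), (nbr (geo9Y x) ((θ.ℓ₆ : ℝ) + 4) y).card ≤ mN)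
    (θ₁ r₁ B₀ δ₀ δK σ ρ a₁ M₁ : ℝ) (hθ₁ : 0 ≤ θ₁) (hB₀ : 0 ≤ B₀) (hσ : 0 < σ) (hρ : 0 < ρ) (hρS : ρ ≤ δ₀) (hρδ : ρ + σ ≤ δK)
    (ha₁ : 0 < a₁) (hM₁ : 0 < M₁) (hgeo : ∀ x : MemberY θ.d₆ θ.ℓ₆ θ.hd' θ.hL' θ.b₀ θ.b₁ Mstar, GeoOK (geo9Y x))
    (hmodel : ∀ x : MemberY θ.d₆ θ.ℓ₆ θ.hd' θ.hL' θ.b₀ θ.b₁ Mstar, M₁ ≤ (geo9Y x).M → ∀ α₀ : ℝ, 0 < α₀ → (geo9Y x).M * α₀ ≤ a₁ →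
      ∀ U : (bg9Y (Matrix (Fin N) (Fin N) ℂ) (specialUnitaryUnits (Fin N)) x).Cfg,
        (bg9Y (Matrix (Fin N) (Fin N) ℂ) (specialUnitaryUnits (Fin N)) x).Reg335 c35 α₀ U →
        (bg9Y (Matrix (Fin N) (Fin N) ℂ) (specialUnitaryUnits (Fin N)) x).Reg336 c35 α₀ U →
          Thm33G0 (𝔬 x) 1 (H₀ x) B₀ δ₀ U ∧
          Step (𝔬 x) 1 (H₀ x) (hgeo x).lenle 1 (θ₁ * ((geo9Y x).M * α₀)) δK U ∧
          Step (𝔬 x) 1 (H₀ x) (hgeo x).lenle 2 (θ₁ * ((geo9Y x).M * α₀)) δK U ∧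
          FormSmall (𝔬 x) (r₁ * ((geo9Y x).M * α₀)) U ∧ Identities (𝔬 x) U)
    (a311 M311 : ℝ) (ha311 : 0 < a311) (hM311 : 0 < M311)
    (hΔA : ∀ x : MemberY θ.d₆ θ.ℓ₆ θ.hd' θ.hL' θ.b₀ θ.b₁ Mstar, M311 ≤ (geo9Y x).M → ∀ α₀ : ℝ, 0 < α₀ → (geo9Y x).M * α₀ ≤ a311 →
      ∀ U : (bg9Y (Matrix (Fin N) (Fin N) ℂ) (specialUnitaryUnits (Fin N)) x).Cfg, (bg9Y (Matrix (Fin N) (Fin N) ℂ) (specialUnitaryUnits (Fin N)) x).Reg335 c35 α₀ U →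
        PosDefTr (fun _ => (1 : ℝ)) (deltaAY x.toKIdx (parSymY x.toKIdx) (parBY x.toKIdx) (GpY x.toKIdx (parSymY x.toKIdx)) U))
    (hP1 : ∃ Mt aT C : ℝ, 0 < Mt ∧ 0 < aT ∧ 0 < C ∧
      ∀ x : MemberY θ.d₆ θ.ℓ₆ θ.hd' θ.hL' θ.b₀ θ.b₁ Mstar, Mt ≤ (geo9Y x).M → ∀ α₀ : ℝ, 0 < α₀ → (geo9Y x).M * α₀ ≤ aT →
        ∀ U : (bg9Y (Matrix (Fin N) (Fin N) ℂ) (specialUnitaryUnits (Fin N)) x).Cfg,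
          (bg9Y (Matrix (Fin N) (Fin N) ℂ) (specialUnitaryUnits (Fin N)) x).Reg335 c35 α₀ U → (bg9Y (Matrix (Fin N) (Fin N) ℂ) (specialUnitaryUnits (Fin N)) x).Reg336 c35 α₀ U →
            ∀ Ψ : IBondY x.toKIdx → Matrix (Fin N) (Fin N) ℂ,
              trIP (fun _ => (1 : ℝ)) (tentOp x.toKIdx (bumpProfile x.toKIdx) U Ψ)
                  (deltaAY x.toKIdx (parSymY x.toKIdx) (parBY x.toKIdx) (GpY x.toKIdx (parSymY x.toKIdx)) U (tentOp x.toKIdx (bumpProfile x.toKIdx) U Ψ)) ≤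
                C * trIP (fun _ => (1 : ℝ)) Ψ Ψ) :
    CoerciveUnder c35
        (fun x : MemberY θ.d₆ θ.ℓ₆ θ.hd' θ.hL' θ.b₀ θ.b₁ Mstar => geoComap (geo9Y x) (Prod.fst : (geo9Y x).Site × TrIdx N → (geo9Y x).Site))
        (bg9Y (Matrix (Fin N) (Fin N) ℂ) (specialUnitaryUnits (Fin N)))
        (fun x U => normMatY (trBasis N) (lamInvY x.toKIdx) (QGQY x.toKIdx (parSymY x.toKIdx) (parBY x.toKIdx) (GpY x.toKIdx (parSymY x.toKIdx)) U)) ∧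
      CoerciveUnder c35
        (fun x : MemberY θ.d₆ θ.ℓ₆ θ.hd' θ.hL' θ.b₀ θ.b₁ Mstar => geoComap (geo9Y x) (Prod.fst : (geo9Y x).Site × TrIdx N → (geo9Y x).Site))
        (bg9Y (Matrix (Fin N) (Fin N) ℂ) (specialUnitaryUnits (Fin N)))
        (fun x U => normMatY (trBasis N) (lamInvY x.toKIdx)
          (QGQOfY x.toKIdx (parBY x.toKIdx) (G1Y x.toKIdx (parSymY x.toKIdx) (parBY x.toKIdx) (GpY x.toKIdx (parSymY x.toKIdx)) (𝔯 x).Δ2) U)) :=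
  hco26_of_hcoA_step12 θ Mstar 𝔯 bK (trBasis N) 𝔬 H₀ hblk hGco hG1co hG0co hlev hβ1 hnbr θ₁ r₁ B₀ δ₀ δK σ ρ a₁ M₁ hθ₁ hB₀ hσ hρ hρS hρδ ha₁ hM₁ hgeo hmodel
    (hcoA_of_energy θ Mstar 𝔯 a311 M311 ha311 hM311 hΔA hP1)

end Literature.MathematicalPhysics.QuantumFieldTheory.Balaban1983to89.B9Eq3132CoerciveFromEnergy

end
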